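import Literature.MathematicalPhysics.QuantumLattice.SourcedGroundEnergyCusp
import Literature.MathematicalPhysics.QuantumLattice.DWaveSourceNNNHoppingOrderParameter
import HarnessLib

/-!
# The `t–t′` `d`-wave order parameter is the CUSP of the thermodynamic-limit sourced energy density:
# Griffiths' lemma in the source `h` and `dWaveOrderParameterTT' t′ U μ = −½ ∂⁺g(0)` (conditional on the limit)

Topic `Literature/MathematicalPhysics/QuantumLattice` (namespace = path). Proof-only `t′ ≠ 0` TWIN of
`DWaveSourceEnergyDensityLimit.lean` (the `t′ = 0` file), written on the `t–t′` pinning-field objects of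
`DWaveSourceNNNHopping.lean` / `PinningFieldPairingOrder.lean` / `DWaveSourceNNNHoppingOrderParameter.lean`:
the pair-sourced grand-canonical `t–t′` Hubbard torus
`dWaveSourceTorusTT' L t′ U μ h = H(1,t′,U) − μN − h(Δ_d + Δ_d†)`, its sourced pair density
`m_L(h) = dWaveSourceDensityTT' L t′ U μ h = Re ω_h(Δ_d)/L²` (tree units = HALF of Koma–Tasaki's `m`,
`= 4×` the printed `Δ_d` of Qin et al. / Xu et al., `pinningFieldPairingOrder_eq`), sourced ground energies
`E_L(h) = E₀(dWaveSourceTorusTT' L t′ U μ h)`, and the Koma–Tasaki order parameter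
`dWaveOrderParameterTT' t′ U μ = liminf_{h→0⁺} liminf_L m_{L+1}(h)`. The model-free real analysis is
`SourcedGroundEnergyCusp.lean` (namespace `SourceSandwich`); this file instantiates it at `t′`, exactly as
the `t′ = 0` file does for `dWaveSourceTorus`. Written for the pinning-field programme of the Hubbard
ladder at the cuprate anchor `(U, n, t′) = (8, 7/8, −1/4)` (rung CQ, rows PC-a "pinning-field response" /
PC-c "non-analyticity of `e₀(h)`"). No definition, no named fact, no `sorry`; zero compute.

## Contents

* STAIRCASE FORM of the order parameter: `dWaveOrderParameterTT' t′ U μ = ⨅_{h>0} liminf_L m_{L+1}(h)`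
  (`dWaveOrderParameterTT'_eq_iInf`; the `t′ = 0` statement is `dWaveOrderParameter_eq_iInf`), from the
  levers `dWaveOrderParameterTT'_le_liminf` / `le_dWaveOrderParameterTT'_of_forall`.
* FINITE VOLUME: the per-site Hellmann–Feynman sandwich `(h′ − h)·2m_L(h) ≤ E_L(h)/L² − E_L(h′)/L²`
  (`dWaveSourceTT'_sandwich`, = `dWaveSourceDensityTT'_mul_le_groundEnergy_drop`); `h ↦ E_L(h)` is
  CONCAVE on `ℝ` (`concaveOn_groundEnergy_dWaveSourceTorusTT'`) and `2B_dL²`-Lipschitz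
  (`abs_groundEnergy_dWaveSourceTorusTT'_sub_le`; `B_d = 2Σ_e|d(e)/√2| = 4√2`, the tree's bound
  `abs_dWaveSourceDensityTT'_le` on `|m_L|`).
* THERMODYNAMIC LIMIT, CONDITIONAL on the sourced energy density: IF `E_{L+1}(h)/(L+1)² → g(h)` for
  every `h ≥ 0` (hypothesis `hg`, the shape used in `SourcedOrderParameterFloorTTPrime.lean` §3 on the
  Summits side; the existence of this limit is NOT in the tree for `d = 2`), THEN
  - `g` is concave and `2B_d`-Lipschitz on `[0,∞)`;
  - GRIFFITHS' LEMMA in the source: at a differentiability point `h` of `g`, `m_{L+1}(h) → −g′(h)/2`;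
    one-sided: `−g′₋(h)/2 ≤ liminf_L m_{L+1}(h)`, `limsup_L m_{L+1}(h) ≤ −g′₊(h)/2`;
  - THE CUSP IDENTITY `dWaveOrderParameterTT' t′ U μ = ⨅_{h>0} (g(0) − g(h))/(2h)
    = lim_{h→0⁺} (g(0) − g(h))/(2h)` (the secant is non-decreasing in `h`), `= −g′₊(0)/2` whenever `g`
    has a right derivative at `0`; hence ONE thermodynamic-limit stair bounds the order parameter from
    ABOVE, `dWaveOrderParameterTT' t′ U μ ≤ (g(0) − g(h))/(2h)` (`dWaveOrderParameterTT'_le_slope`);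
  - `HasDWaveOrderTT' t′ U μ ↔ ∃ c > 0, ∀ h > 0, g(h) ≤ g(0) − 2ch` (Koma–Tasaki `d`-wave order IS a
    linear cusp of the sourced energy density at `h = 0`), `HasDWaveOrderTT' t′ U μ ↔ g′₊(0) < 0` when
    the right derivative exists, and no kink (`g′₊(0) = 0`) ⇒ `¬ HasDWaveOrderTT' t′ U μ`.
  At `t′ = 0` every statement reduces to its `DWaveSourceEnergyDensityLimit.lean` namesake by the `simp`
  lemmas `dWaveSourceTorusTT'_zero_tp`, `dWaveSourceDensityTT'_zero`, `dWaveOrderParameterTT'_zero`.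

## What is NOT here (honest scope)

* The EXISTENCE of `g` is a hypothesis; nothing here constructs it. A certified floor on `m_L(h)` or on
  the gain `g(0) − g(h)` at ONE `h > 0` bounds `dWaveOrderParameterTT'` from ABOVE only
  (`dWaveOrderParameterTT'_le_liminf`, and here `dWaveOrderParameterTT'_le_slope`); a floor needs every
  stair (`le_dWaveOrderParameterTT'_iff_forall`) — the cusp identity names the missing `h → 0⁺`
  uniformity exactly.
* No inequality relating `dWaveOrderParameterTT'` to long-range order (Kennedy–Lieb–Shastry 1988 /
  Koma–Tasaki 1993 go LRO ⇒ response; the converse is the catalogued barrier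
  `Literature.Barriers.HubbardSuperconductivity.SourcedOrderWithoutGroundStateLRO`).
* Window-fed finite-volume / stair / `Tendsto` brackets at `t′`: `SourcedOrderParameterFloorTTPrime.lean`,
  `SourcedOrderParameterCeilingInputsTTPrime.lean`, `PinningFieldChords.lean` (Summits side); not restated.

## References

* R. B. Griffiths, *Spontaneous magnetization in idealized ferromagnets*, Phys. Rev. 152 (1966)
  240–246, §II. [cite: Griffiths1966, §II]
* T. Koma, H. Tasaki, *Symmetry breaking and finite-size effects in quantum many-body systems*,
  J. Stat. Phys. 76 (1994) 745–803, §1. [cite: KomaTasaki1994, §1]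
* H. Xu, C.-M. Chung, M. Qin, U. Schollwöck, S. R. White, S. Zhang, *Coexistence of superconductivity
  with partially filled stripes in the Hubbard model*, Science 384 (2024) eadh7691, eq. (1) and §III.B
  (the `t–t′` model with a `d`-wave pinning field). [cite: XuEtAl2024, eq. (1) p. 2]
-/

noncomputable section

namespace Literature.MathematicalPhysics.QuantumLattice

open Filter Set
open scoped Topology

section DWaveTTPrime

open Literature.Probability.LatticeModels

variable (t' U μ : ℝ)

/-! ### The staircase form of the `t–t′` order parameter -/

/-- **Staircase form**: `dWaveOrderParameterTT' t′ U μ = ⨅_{h>0} liminf_L m_{L+1}(h)` — the `liminf` over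
`h → 0⁺` of the non-decreasing, non-negative stair `h ↦ liminf_L dWaveSourceDensityTT' (L+1) t′ U μ h`
is its infimum over `h > 0` (`t′ = 0`: `dWaveOrderParameter_eq_iInf`). [cite: KomaTasaki1994, §1] -/
theorem dWaveOrderParameterTT'_eq_iInf :
    dWaveOrderParameterTT' t' U μ =
      ⨅ h : Set.Ioi (0 : ℝ), liminf (fun L : ℕ => dWaveSourceDensityTT' (L + 1) t' U μ h) atTop := by
  haveI : Nonempty (Set.Ioi (0 : ℝ)) := ⟨⟨1, Set.mem_Ioi.2 one_pos⟩⟩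
  refine le_antisymm (le_ciInf fun h => dWaveOrderParameterTT'_le_liminf t' U μ h.2) ?_
  refine le_dWaveOrderParameterTT'_of_forall t' U μ zero_lt_one fun h hh => ?_
  have hbdd : BddBelow (Set.range fun h' : Set.Ioi (0 : ℝ) =>
      liminf (fun L : ℕ => dWaveSourceDensityTT' (L + 1) t' U μ h') atTop) := by
    refine ⟨0, ?_⟩
    rintro _ ⟨h', rfl⟩
    exact liminf_dWaveSourceDensityTT'_nonneg t' U μ (le_of_lt h'.2)
  exact ciInf_le hbdd ⟨h, hh.1⟩

/-! ### Finite volume -/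

/-- The Hellmann–Feynman sandwich PER SITE for the `d`-wave sourced `t–t′` torus:
`(h′ − h)·2m_L(h) ≤ E_L(h)/L² − E_L(h′)/L²` for all real `h, h′`
(`dWaveSourceDensityTT'_mul_le_groundEnergy_drop`). [cite: KomaTasaki1994, §1] -/
theorem dWaveSourceTT'_sandwich (L : ℕ) [NeZero L] (h h' : ℝ) :
    (h' - h) * (2 * dWaveSourceDensityTT' L t' U μ h) ≤
      (dWaveSourceTorusTT' L t' U μ h).groundEnergy / (L : ℝ) ^ 2 -
        (dWaveSourceTorusTT' L t' U μ h').groundEnergy / (L : ℝ) ^ 2 := by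
  have key := dWaveSourceDensityTT'_mul_le_groundEnergy_drop (L := L) t' U μ h h'
  have hL := cast_sq_pos_of_neZero L
  rw [← sub_div, le_div_iff₀ hL]
  calc (h' - h) * (2 * dWaveSourceDensityTT' L t' U μ h) * (L : ℝ) ^ 2
      = (h' - h) * (2 * (L : ℝ) ^ 2 * dWaveSourceDensityTT' L t' U μ h) := by ring
    _ ≤ _ := key

/-- **Concavity in the source, finite volume**: `h ↦ E₀(dWaveSourceTorusTT' L t′ U μ h)` is concave on
`ℝ` (a minimum of affine functions of `h`; here from the Hellmann–Feynman sandwich).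
[cite: KomaTasaki1994, §1] -/
theorem concaveOn_groundEnergy_dWaveSourceTorusTT' (L : ℕ) [NeZero L] :
    ConcaveOn ℝ Set.univ fun h : ℝ => (dWaveSourceTorusTT' L t' U μ h).groundEnergy :=
  SourceSandwich.concaveOn_univ (r := fun h => (L : ℝ) ^ 2 * dWaveSourceDensityTT' L t' U μ h)
    fun h h' => by
      simpa only [mul_assoc] using dWaveSourceDensityTT'_mul_le_groundEnergy_drop (L := L) t' U μ h h'

/-- **Lipschitz continuity in the source, finite volume**:
`|E₀(dWaveSourceTorusTT' L t′ U μ h) − E₀(dWaveSourceTorusTT' L t′ U μ h′)| ≤ 2B_d L² |h − h′|`,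
`B_d = 2Σ_e|d(e)/√2|` (Weyl; Israel's Thm. I.3.4 is the pressure version). [cite: Israel1979, Thm. I.3.4] -/
theorem abs_groundEnergy_dWaveSourceTorusTT'_sub_le (L : ℕ) [NeZero L] (h h' : ℝ) :
    |(dWaveSourceTorusTT' L t' U μ h).groundEnergy - (dWaveSourceTorusTT' L t' U μ h').groundEnergy| ≤
      2 * ((2 * ∑ e ∈ insert (0 : Site 2) unitSteps, |dWaveFormFactor e / Real.sqrt 2|) * (L : ℝ) ^ 2) *
        |h - h'| := by
  refine SourceSandwich.abs_sub_le (e := fun h => (dWaveSourceTorusTT' L t' U μ h).groundEnergy)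
    (r := fun h => (L : ℝ) ^ 2 * dWaveSourceDensityTT' L t' U μ h)
    (B := (2 * ∑ e ∈ insert (0 : Site 2) unitSteps, |dWaveFormFactor e / Real.sqrt 2|) * (L : ℝ) ^ 2)
    (fun h h' => ?_) (fun h => ?_) h h'
  · simpa only [mul_assoc] using dWaveSourceDensityTT'_mul_le_groundEnergy_drop (L := L) t' U μ h h'
  · rw [abs_mul, abs_of_nonneg (by positivity), mul_comm]
    exact mul_le_mul_of_nonneg_right (abs_dWaveSourceDensityTT'_le L t' U μ h) (by positivity)

/-! #### Thermodynamic limit, conditional on the sourced energy density `g` -/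

/-- IF `E_{L+1}(h)/(L+1)² → g(h)` for all `h ≥ 0`, THEN `g` is concave on `[0,∞)`.
[cite: KomaTasaki1994, §1] -/
theorem concaveOn_Ici_of_tendsto_groundEnergy_dWaveSourceTT' {g : ℝ → ℝ}
    (hg : ∀ h : ℝ, 0 ≤ h → Tendsto (fun L : ℕ =>
      (dWaveSourceTorusTT' (L + 1) t' U μ h).groundEnergy / (((L + 1 : ℕ) : ℝ)) ^ 2) atTop (𝓝 (g h))) :
    ConcaveOn ℝ (Set.Ici 0) g :=
  SourceSandwich.concaveOn_Ici (m := fun L h => dWaveSourceDensityTT' (L + 1) t' U μ h)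
    (fun L h h' => dWaveSourceTT'_sandwich t' U μ (L + 1) h h') hg

/-- IF the limits exist at `h, h′`, THEN `|g(h) − g(h′)| ≤ 2B_d|h − h′|`. [cite: Israel1979, Thm. I.3.4] -/
theorem abs_sub_le_of_tendsto_groundEnergy_dWaveSourceTT' {g : ℝ → ℝ} {h h' : ℝ}
    (hgh : Tendsto (fun L : ℕ =>
      (dWaveSourceTorusTT' (L + 1) t' U μ h).groundEnergy / (((L + 1 : ℕ) : ℝ)) ^ 2) atTop (𝓝 (g h)))
    (hgh' : Tendsto (fun L : ℕ =>
      (dWaveSourceTorusTT' (L + 1) t' U μ h').groundEnergy / (((L + 1 : ℕ) : ℝ)) ^ 2) atTop (𝓝 (g h'))) :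
    |g h - g h'| ≤ 2 * (2 * ∑ e ∈ insert (0 : Site 2) unitSteps, |dWaveFormFactor e / Real.sqrt 2|) *
      |h - h'| :=
  SourceSandwich.abs_sub_le_of_tendsto (m := fun L h => dWaveSourceDensityTT' (L + 1) t' U μ h)
    (fun L h h' => dWaveSourceTT'_sandwich t' U μ (L + 1) h h')
    (fun L h => abs_dWaveSourceDensityTT'_le (L + 1) t' U μ h) hgh hgh'

/-- **Griffiths' lemma in the source** (conditional): IF `E_{L+1}(h′)/(L+1)² → g(h′)` for every `h′`
near `h` and `g` is differentiable at `h` with derivative `g′`, THEN the sourced pair densities converge,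
`m_{L+1}(h) → −g′/2`. [cite: Griffiths1966, §II] -/
theorem tendsto_dWaveSourceDensityTT'_of_hasDerivAt {g : ℝ → ℝ} {h g' : ℝ}
    (hg : ∀ᶠ h' in 𝓝 h, Tendsto (fun L : ℕ =>
      (dWaveSourceTorusTT' (L + 1) t' U μ h').groundEnergy / (((L + 1 : ℕ) : ℝ)) ^ 2) atTop (𝓝 (g h')))
    (hd : HasDerivAt g g' h) :
    Tendsto (fun L : ℕ => dWaveSourceDensityTT' (L + 1) t' U μ h) atTop (𝓝 (-g' / 2)) :=
  SourceSandwich.tendsto_of_hasDerivAt (m := fun L h => dWaveSourceDensityTT' (L + 1) t' U μ h)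
    (fun L h h' => dWaveSourceTT'_sandwich t' U μ (L + 1) h h')
    (fun L h => abs_dWaveSourceDensityTT'_le (L + 1) t' U μ h) hg hd

/-- **Griffiths' lemma in the source, left half** (conditional): a LEFT derivative `g′₋(h)` of the
limit energy density bounds the stair from below, `−g′₋(h)/2 ≤ liminf_L m_{L+1}(h)`.
[cite: Griffiths1966, §II] -/
theorem neg_half_deriv_le_liminf_dWaveSourceDensityTT' {g : ℝ → ℝ} {h g' : ℝ}
    (hg : ∀ᶠ h₁ in 𝓝[<] h, Tendsto (fun L : ℕ =>
      (dWaveSourceTorusTT' (L + 1) t' U μ h₁).groundEnergy / (((L + 1 : ℕ) : ℝ)) ^ 2) atTop (𝓝 (g h₁)))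
    (hgh : Tendsto (fun L : ℕ =>
      (dWaveSourceTorusTT' (L + 1) t' U μ h).groundEnergy / (((L + 1 : ℕ) : ℝ)) ^ 2) atTop (𝓝 (g h)))
    (hd : HasDerivWithinAt g g' (Set.Iio h) h) :
    -g' / 2 ≤ liminf (fun L : ℕ => dWaveSourceDensityTT' (L + 1) t' U μ h) atTop :=
  SourceSandwich.neg_half_deriv_le_liminf (m := fun L h => dWaveSourceDensityTT' (L + 1) t' U μ h)
    (fun L h h' => dWaveSourceTT'_sandwich t' U μ (L + 1) h h')
    (fun L h => abs_dWaveSourceDensityTT'_le (L + 1) t' U μ h) hg hgh hd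

/-- **Griffiths' lemma in the source, right half** (conditional): a RIGHT derivative `g′₊(h)` of the
limit energy density bounds the stair from above, `limsup_L m_{L+1}(h) ≤ −g′₊(h)/2`.
[cite: Griffiths1966, §II] -/
theorem limsup_dWaveSourceDensityTT'_le_neg_half_deriv {g : ℝ → ℝ} {h g' : ℝ}
    (hg : ∀ᶠ h₂ in 𝓝[>] h, Tendsto (fun L : ℕ =>
      (dWaveSourceTorusTT' (L + 1) t' U μ h₂).groundEnergy / (((L + 1 : ℕ) : ℝ)) ^ 2) atTop (𝓝 (g h₂)))
    (hgh : Tendsto (fun L : ℕ =>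
      (dWaveSourceTorusTT' (L + 1) t' U μ h).groundEnergy / (((L + 1 : ℕ) : ℝ)) ^ 2) atTop (𝓝 (g h)))
    (hd : HasDerivWithinAt g g' (Set.Ioi h) h) :
    limsup (fun L : ℕ => dWaveSourceDensityTT' (L + 1) t' U μ h) atTop ≤ -g' / 2 :=
  SourceSandwich.limsup_le_neg_half_deriv (m := fun L h => dWaveSourceDensityTT' (L + 1) t' U μ h)
    (fun L h h' => dWaveSourceTT'_sandwich t' U μ (L + 1) h h')
    (fun L h => abs_dWaveSourceDensityTT'_le (L + 1) t' U μ h) hg hgh hd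

/-- **THE CUSP IDENTITY, infimum form** (conditional): IF `E_{L+1}(h)/(L+1)² → g(h)` for all `h ≥ 0`,
THEN `dWaveOrderParameterTT' t′ U μ = ⨅_{h>0} (g(0) − g(h))/(2h)`: the Koma–Tasaki `d`-wave order
parameter of the `t–t′` model is the largest `c` with `g(h) ≤ g(0) − 2ch` for all `h > 0`.
[cite: KomaTasaki1994, §1] -/
theorem dWaveOrderParameterTT'_eq_iInf_slope {g : ℝ → ℝ}
    (hg : ∀ h : ℝ, 0 ≤ h → Tendsto (fun L : ℕ =>
      (dWaveSourceTorusTT' (L + 1) t' U μ h).groundEnergy / (((L + 1 : ℕ) : ℝ)) ^ 2) atTop (𝓝 (g h))) :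
    dWaveOrderParameterTT' t' U μ = ⨅ h : Set.Ioi (0 : ℝ), (g 0 - g h) / (2 * h) := by
  rw [dWaveOrderParameterTT'_eq_iInf]
  exact SourceSandwich.iInf_liminf_eq_iInf_slope (m := fun L h => dWaveSourceDensityTT' (L + 1) t' U μ h)
    (fun L h h' => dWaveSourceTT'_sandwich t' U μ (L + 1) h h')
    (fun L h => abs_dWaveSourceDensityTT'_le (L + 1) t' U μ h) hg

/-- **THE CUSP IDENTITY, limit form** (conditional): IF `E_{L+1}(h)/(L+1)² → g(h)` for all `h ≥ 0`,
THEN `(g(0) − g(h))/(2h) → dWaveOrderParameterTT' t′ U μ` as `h → 0⁺` (the secant is non-decreasing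
in `h`, so this is also its infimum). [cite: KomaTasaki1994, §1] -/
theorem tendsto_slope_nhdsGT_dWaveOrderParameterTT' {g : ℝ → ℝ}
    (hg : ∀ h : ℝ, 0 ≤ h → Tendsto (fun L : ℕ =>
      (dWaveSourceTorusTT' (L + 1) t' U μ h).groundEnergy / (((L + 1 : ℕ) : ℝ)) ^ 2) atTop (𝓝 (g h))) :
    Tendsto (fun h : ℝ => (g 0 - g h) / (2 * h)) (𝓝[>] 0) (𝓝 (dWaveOrderParameterTT' t' U μ)) := by
  rw [dWaveOrderParameterTT'_eq_iInf]
  exact SourceSandwich.tendsto_slope_nhdsGT (m := fun L h => dWaveSourceDensityTT' (L + 1) t' U μ h)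
    (fun L h h' => dWaveSourceTT'_sandwich t' U μ (L + 1) h h')
    (fun L h => abs_dWaveSourceDensityTT'_le (L + 1) t' U μ h) hg

/-- **One thermodynamic-limit stair bounds the order parameter from ABOVE** (conditional): IF
`E_{L+1}(h′)/(L+1)² → g(h′)` for all `h′ ≥ 0`, THEN for every `h > 0`,
`dWaveOrderParameterTT' t′ U μ ≤ (g(0) − g(h))/(2h)` — a certified GAIN `g(0) − g(h)` at one field is a
CEILING on the quasi-average, never a floor (the secant is non-decreasing and tends to the order
parameter as `h → 0⁺`). [cite: KomaTasaki1994, §1] -/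
theorem dWaveOrderParameterTT'_le_slope {g : ℝ → ℝ}
    (hg : ∀ h : ℝ, 0 ≤ h → Tendsto (fun L : ℕ =>
      (dWaveSourceTorusTT' (L + 1) t' U μ h).groundEnergy / (((L + 1 : ℕ) : ℝ)) ^ 2) atTop (𝓝 (g h)))
    {h : ℝ} (hh : 0 < h) :
    dWaveOrderParameterTT' t' U μ ≤ (g 0 - g h) / (2 * h) := by
  refine le_of_tendsto (tendsto_slope_nhdsGT_dWaveOrderParameterTT' t' U μ hg) ?_
  filter_upwards [Ioo_mem_nhdsGT hh] with h' hh'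
  exact SourceSandwich.monotoneOn_slope_of_concaveOn
    (concaveOn_Ici_of_tendsto_groundEnergy_dWaveSourceTT' t' U μ hg) (Set.mem_Ioi.2 hh'.1)
    (Set.mem_Ioi.2 hh) hh'.2.le

/-- **THE CUSP IDENTITY, derivative form** (conditional): IF `E_{L+1}(h)/(L+1)² → g(h)` for all
`h ≥ 0` and `g` has a right derivative `g′₊(0)` at `h = 0`, THEN
`dWaveOrderParameterTT' t′ U μ = −g′₊(0)/2`. [cite: Griffiths1966, §II] -/
theorem dWaveOrderParameterTT'_eq_neg_half_deriv {g : ℝ → ℝ} {g' : ℝ}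
    (hg : ∀ h : ℝ, 0 ≤ h → Tendsto (fun L : ℕ =>
      (dWaveSourceTorusTT' (L + 1) t' U μ h).groundEnergy / (((L + 1 : ℕ) : ℝ)) ^ 2) atTop (𝓝 (g h)))
    (hd : HasDerivWithinAt g g' (Set.Ioi 0) 0) :
    dWaveOrderParameterTT' t' U μ = -g' / 2 := by
  rw [dWaveOrderParameterTT'_eq_iInf]
  exact SourceSandwich.iInf_liminf_eq_neg_half_deriv
    (m := fun L h => dWaveSourceDensityTT' (L + 1) t' U μ h)
    (fun L h h' => dWaveSourceTT'_sandwich t' U μ (L + 1) h h')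
    (fun L h => abs_dWaveSourceDensityTT'_le (L + 1) t' U μ h) hg hd

/-- **`d`-wave order IS a linear cusp of the sourced energy density** (conditional): IF
`E_{L+1}(h)/(L+1)² → g(h)` for all `h ≥ 0`, THEN
`HasDWaveOrderTT' t′ U μ ↔ ∃ c > 0, ∀ h > 0, g(h) ≤ g(0) − 2ch`. [cite: KomaTasaki1994, §1] -/
theorem hasDWaveOrderTT'_iff_linear_cusp {g : ℝ → ℝ}
    (hg : ∀ h : ℝ, 0 ≤ h → Tendsto (fun L : ℕ =>
      (dWaveSourceTorusTT' (L + 1) t' U μ h).groundEnergy / (((L + 1 : ℕ) : ℝ)) ^ 2) atTop (𝓝 (g h))) :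
    HasDWaveOrderTT' t' U μ ↔ ∃ c : ℝ, 0 < c ∧ ∀ h : ℝ, 0 < h → g h ≤ g 0 - 2 * c * h := by
  rw [HasDWaveOrderTT', dWaveOrderParameterTT'_eq_iInf]
  exact SourceSandwich.iInf_liminf_pos_iff_linear_cusp
    (m := fun L h => dWaveSourceDensityTT' (L + 1) t' U μ h)
    (fun L h h' => dWaveSourceTT'_sandwich t' U μ (L + 1) h h')
    (fun L h => abs_dWaveSourceDensityTT'_le (L + 1) t' U μ h) hg

/-- **No kink, no order** (conditional): IF `E_{L+1}(h)/(L+1)² → g(h)` for all `h ≥ 0` and the right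
derivative of `g` at `0` vanishes, THEN `¬ HasDWaveOrderTT' t′ U μ`. [cite: KomaTasaki1994, §1] -/
theorem not_hasDWaveOrderTT'_of_hasDerivWithinAt_zero {g : ℝ → ℝ}
    (hg : ∀ h : ℝ, 0 ≤ h → Tendsto (fun L : ℕ =>
      (dWaveSourceTorusTT' (L + 1) t' U μ h).groundEnergy / (((L + 1 : ℕ) : ℝ)) ^ 2) atTop (𝓝 (g h)))
    (hd : HasDerivWithinAt g 0 (Set.Ioi 0) 0) : ¬ HasDWaveOrderTT' t' U μ := by
  rw [HasDWaveOrderTT', dWaveOrderParameterTT'_eq_neg_half_deriv t' U μ hg hd]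
  norm_num

/-- **The sign of the kink decides** (conditional): IF `E_{L+1}(h)/(L+1)² → g(h)` for all `h ≥ 0` and
`g` has right derivative `g′₊(0)` at `0`, THEN `HasDWaveOrderTT' t′ U μ ↔ g′₊(0) < 0`.
[cite: KomaTasaki1994, §1] -/
theorem hasDWaveOrderTT'_iff_deriv_neg {g : ℝ → ℝ} {g' : ℝ}
    (hg : ∀ h : ℝ, 0 ≤ h → Tendsto (fun L : ℕ =>
      (dWaveSourceTorusTT' (L + 1) t' U μ h).groundEnergy / (((L + 1 : ℕ) : ℝ)) ^ 2) atTop (𝓝 (g h)))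
    (hd : HasDerivWithinAt g g' (Set.Ioi 0) 0) : HasDWaveOrderTT' t' U μ ↔ g' < 0 := by
  rw [HasDWaveOrderTT', dWaveOrderParameterTT'_eq_neg_half_deriv t' U μ hg hd]
  constructor <;> intro H <;> linarith

end DWaveTTPrime

end Literature.MathematicalPhysics.QuantumLattice

end
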